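import Mathlib
import Summits.Ventures.PercRepro2.CoinForestHead
import Summits.Ventures.PercRepro2.CoinPin
import Summits.Ventures.PercRepro2.CoinPreHead
import Summits.Ventures.PercRepro2.CoinDiamond

/-!
# The diamond theorem on the LITERAL OR-FORK — an instantiation check (blind cell PercRepro2,
night-2 g6; NIGHT2-DARC.md §28.2, §29.3)

A concrete coin system on `Fin 9` (s = 0, a = 1, b = 2, u = 3, w = 4, v₀ = 5, v₁ = 6, v₂ = 7,
t = 8) with ten single-arc coins: the diamond w → v₀ → {v₁, v₂} → t (pre-head arm `e₀`, inner arcs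
`c₁, c₂`, leaves `d₁, d₂`) and the core / entries s → a, s → b, s → u, a → v₁, b → v₂ — the
«OR-fork with marker entries» family of §28 on which the tilt lemma of the k-star / forest method
fails for every arm probability, and on which the row holds.  Every STRUCTURAL hypothesis of
`darc_of_diamond` is discharged by `decide`; the theorem gives row 2′DARC at the arc `u → w` for
EVERY probability vector `p` (all five head coins random) under the two non-degeneracy hypotheses
`hP`, `hQ` of the head `{v₀, v₁, v₂}`.  The point of the file: the hypotheses of the diamond theorem
are satisfiable, and they hold on the very family that killed the previous method.
-/

namespace Summit.Ventures.PercRepro2.Coin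

namespace DiamondExample

open Classical

/-- The ten coins of the example. -/
def arcsEx : Fin 10 → Finset (Fin 9 × Fin 9)
  | 0 => {(4, 5)}   -- e₀: pre-head arm w → v₀
  | 1 => {(5, 6)}   -- c₁: v₀ → v₁
  | 2 => {(5, 7)}   -- c₂: v₀ → v₂
  | 3 => {(6, 8)}   -- d₁: v₁ → t
  | 4 => {(7, 8)}   -- d₂: v₂ → t
  | 5 => {(0, 1)}   -- s → a
  | 6 => {(0, 2)}   -- s → b
  | 7 => {(0, 3)}   -- s → u
  | 8 => {(1, 6)}   -- a → v₁ (marker entry into the first branch)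
  | 9 => {(2, 7)}   -- b → v₂ (marker entry into the second branch)

/-- Every coin is a single arc, so `SameEnds` holds. -/
lemma sameEnds_ex : SameEnds arcsEx := by
  intro e xy hxy x'y' hx'y'
  fin_cases e <;> simp [arcsEx] at hxy hx'y' <;> subst hxy <;> subst hx'y' <;>
    exact ⟨Or.inl rfl, Or.inr rfl⟩

/-- No coin has an arc into `w = 4`. -/
lemma hin_ex : ∀ e, ∀ xy ∈ arcsEx e, xy.2 ≠ 4 := by decide

/-- The pre-head arm is the only coin leaving `w`. -/
lemma hout_ex : ∀ e, (∃ xy ∈ arcsEx e, xy.1 = 4) → e = 0 := by decide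

/-- The four head coins are the only coins leaving `{v₀, v₁, v₂}`. -/
lemma honly_ex : ∀ e, (∃ xy ∈ arcsEx e, xy.1 = 5 ∨ xy.1 = 6 ∨ xy.1 = 7) →
    e = 1 ∨ e = 2 ∨ e = 3 ∨ e = 4 := by decide

/-- **Row 2′DARC at the arc `u → w` of the literal OR-fork, for every probability vector**
(non-degeneracy of the reduced avoidance events of the head `{v₀, v₁, v₂}` assumed). -/
theorem darc_diamond_example {R : Type*} [Field R] [LinearOrder R] [IsStrictOrderedRing R]
    (p : Fin 10 → R) (hp : IsProbVec p)
    (hP : ∀ Z ∈ ({5, 6, 7} : Finset (Fin 9)).powerset,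
      0 < prob p (avoidEvent (arcsOff arcsEx ({5, 6, 7, 8} : Finset (Fin 9))) 0 (Z ∪ {8})))
    (hQ : ∀ Z ∈ ({5, 6, 7} : Finset (Fin 9)).powerset,
      0 < prob p (avoidEvent (arcsOff arcsEx ({5, 6, 7, 8} : Finset (Fin 9))) 0
        (gateTarget 3 5 Z {8}))) :
    DARC p arcsEx 0 {8} 1 2 3 4 :=
  darc_of_diamond p hp sameEnds_ex 0 1 2 3 4 5 6 7 8 0 1 2 3 4 (by decide) (by decide) (by decide)
    (by decide) (by decide) hin_ex hout_ex honly_ex (by decide) (by decide) (by decide) (by decide)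
    (by decide) (by decide) (by decide) (by decide) (by decide) (by decide) (by decide) hP hQ

end DiamondExample

end Summit.Ventures.PercRepro2.Coin
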